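import Literature.Computability.Complexity.TruthTableFunctions
import Literature.Computability.Learning.PAC
import Literature.Computability.Cryptography.OracleGames
import HarnessLib

/-!
# Running a truth-table learner against the PAC oracle with membership queries

Machine-layer instalment (M8a) of the decomposition of the named fact
`Literature.Computability.Learning.cikk_natural_implies_learning` (CIKK 2016, Thm. 5.1): the
run of a non-adaptive (truth-table) oracle transducer `ttFnAlg Q q G` whose queries are all
MEMBERSHIP QUERIES `true :: y` against the PAC oracle `pacOracle true f xs`, and the success
probability of a PAC run whose outcome does not depend on the examples.

* `runIdx_ttFnAlg_mq`: if `Q ⟨x, 1ⁱ⟩ = true :: yᵢ` for all `i < q(|x|)`, then within any budget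
  `> q(|x|)` the run outputs `G ⟨x, (f y₀, …, f y_{q(|x|)-1})⟩`.
* `pacSuccessProb_eq_of_forall`: if the outcome is the same for all example lists, the success
  probability is the probability over the coins alone, a normalised count.

## References

* R. Ladner, N. Lynch, A. Selman, *A comparison of polynomial time reducibilities*, TCS 1
  (1975), §3 [LadnerLynchSelman1975].
* M. Kearns, U. Vazirani, *An Introduction to Computational Learning Theory*, MIT Press 1994,
  §1.2 and §8.1 [KearnsVazirani1994].
-/

namespace Literature.Computability.Learning

open Literature.Computability.Complexity _root_.Computability Polynomial Finset

/-! ### Truth-table transducers with membership queries -/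

section TT

variable {Q G : List Bool → List Bool} {q : Polynomial ℕ} {n : ℕ}

/-- The answer list after `i` membership queries `y₀, …, y_{i-1}`. [folklore] -/
def mqAnswers (f : (Fin n → Bool) → Bool) (y : ℕ → (Fin n → Bool)) (i : ℕ) : List (List Bool) :=
  (List.range i).map fun r => [f (y r)]

omit q in
/-- `mqAnswers` has length `i`. [folklore] -/
@[simp] theorem length_mqAnswers (f : (Fin n → Bool) → Bool) (y : ℕ → (Fin n → Bool)) (i : ℕ) :
    (mqAnswers f y i).length = i := by simp [mqAnswers]

omit q in
/-- The flattened answers are the bits `f yᵣ`. [folklore] -/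
theorem flatten_mqAnswers (f : (Fin n → Bool) → Bool) (y : ℕ → (Fin n → Bool)) :
    ∀ i : ℕ, (mqAnswers f y i).flatten = List.ofFn fun r : Fin i => f (y r)
  | 0 => by simp [mqAnswers]
  | i + 1 => by
    rw [List.ofFn_succ', List.concat_eq_append]
    have ih := flatten_mqAnswers f y i
    simp only [mqAnswers, List.range_succ, List.map_append, List.flatten_append, List.map_cons, List.map_nil,
      List.flatten_cons, List.flatten_nil, List.append_nil] at ih ⊢
    rw [ih]
    rfl

/-- The indexed run of `ttFnAlg` from the answer list of the first `i` membership queries. [folklore] -/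
theorem runIdxAux_ttFnAlg_mq (f : (Fin n → Bool) → Bool) (xs : List (Fin n → Bool)) (x : List Bool)
    (y : ℕ → (Fin n → Bool))
    (hQ : ∀ i < q.eval x.length, Q (boolPair x (List.replicate i true)) = true :: List.ofFn (y i)) :
    ∀ (fuel i : ℕ), i ≤ q.eval x.length → q.eval x.length - i < fuel →
      (ttFnAlg Q q G).runIdxAux (pacOracle true f xs) x fuel (mqAnswers f y i) =
        some (G (boolPair x (List.ofFn fun r : Fin (q.eval x.length) => f (y r))))
  | 0, i, _, hlt => absurd hlt (Nat.not_lt_zero _)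
  | fuel + 1, i, hi, hlt => by
    rw [OracleAlg.runIdxAux]
    rcases Nat.lt_or_eq_of_le hi with h | h
    · rw [ttFnAlg_step_of_lt x (by simpa using h)]
      simp only [length_mqAnswers]
      rw [hQ i h, pacOracle_true_query,
        show mqAnswers f y i ++ [[f (y i)]] = mqAnswers f y (i + 1) by simp [mqAnswers, List.range_succ]]
      exact runIdxAux_ttFnAlg_mq f xs x y hQ fuel (i + 1) h (by omega)
    · rw [ttFnAlg_step_of_le x (by simp [h]), flatten_mqAnswers, h]

/-- **The run of a membership-query truth-table transducer against the PAC oracle.** If every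
query is a membership query, `Q ⟨x, 1ⁱ⟩ = true :: yᵢ`, then within any budget `> q(|x|)` the run
outputs `G ⟨x, (f y₀, …, f y_{q(|x|)-1})⟩`, whatever the examples.
[cite: LadnerLynchSelman1975, §3; KearnsVazirani1994, §8.1 (membership queries)] -/
theorem runIdx_ttFnAlg_mq (f : (Fin n → Bool) → Bool) (xs : List (Fin n → Bool)) (x : List Bool)
    (y : ℕ → (Fin n → Bool))
    (hQ : ∀ i < q.eval x.length, Q (boolPair x (List.replicate i true)) = true :: List.ofFn (y i))
    {T : ℕ} (hT : q.eval x.length < T) :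
    (ttFnAlg Q q G).runIdx (pacOracle true f xs) T x =
      some (G (boolPair x (List.ofFn fun r : Fin (q.eval x.length) => f (y r)))) := by
  rw [OracleAlg.runIdx, show ([] : List (List Bool)) = mqAnswers f y 0 by simp [mqAnswers]]
  exact runIdxAux_ttFnAlg_mq f xs x y hQ T 0 (Nat.zero_le _) (by omega)

end TT

/-! ### Success probability when the examples are not used -/

/-- **A PAC run whose outcome ignores the examples succeeds with the probability over the coins
alone**: if the run's outcome is the same for every example list, `pacSuccessProb` is the
normalised number of good coin strings. [cite: KearnsVazirani1994, §1.2 Def. 1] -/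
theorem pacSuccessProb_eq_card {n : ℕ} (dec : List Bool → ((Fin n → Bool) → Bool)) (mq : Bool)
    (A : OracleAlg (List Bool)) (params : List Bool) (T c : ℕ) (f : (Fin n → Bool) → Bool)
    (D : PMF (Fin n → Bool)) (ε : ℝ) (good : List.Vector Bool c → Bool)
    (h : ∀ (xs : List (Fin n → Bool)) (r : List.Vector Bool c),
      (match A.runIdx (pacOracle mq f xs) T (boolPair params r.toList) with
        | some w => decide (errorProb D (dec w) f ≤ ENNReal.ofReal ε)
        | none => false) = good r) :
    pacSuccessProb dec mq A params T c f D ε =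
      ((Finset.univ.filter fun r : List.Vector Bool c => good r = true).card : ENNReal) / 2 ^ c := by
  classical
  rw [pacSuccessProb]
  have key : ∀ F : List (Fin n → Bool) → PMF Bool,
      (∀ xs, F xs = (PMF.uniformOfFintype (List.Vector Bool c)).map good) →
      ((iidList D T).bind F).toOuterMeasure {true} =
        ((Finset.univ.filter fun r : List.Vector Bool c => good r = true).card : ENNReal) / 2 ^ c := by
    intro F hF
    rw [show F = fun _ => (PMF.uniformOfFintype (List.Vector Bool c)).map good from funext hF, PMF.bind_const,
      PMF.toOuterMeasure_map_apply, PMF.toOuterMeasure_uniformOfFintype_apply]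
    congr 1
    · rw [Fintype.card_ofFinset]
      congr 2
      ext r
      simp
    · simp [card_vector]
  apply key
  intro xs
  exact congrArg (fun g : List.Vector Bool c → Bool => (PMF.uniformOfFintype (List.Vector Bool c)).map g)
    (funext fun r => h xs r)

end Literature.Computability.Learning
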